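import Mathlib
import HarnessLib
import Summits.NavierStokesRegularity.NavierStokesRegularity.Theses.LocalPressureProfileDoor
import Summits.NavierStokesRegularity.NavierStokesRegularity.Theorems.LocalPressureProfileDoorLocalPointZoomSimilarityPressure
import Summits.NavierStokesRegularity.NavierStokesRegularity.Theorems.LocalPressureProfileDoorMonotonePressureProfileRigidity
import Summits.NavierStokesRegularity.NavierStokesRegularity.Theorems.LocalPressureProfileDoorPressureWindowToSlab

/-!
# Door family `LocalPressureProfileDoor` (nsreg-p1 ROUND-16) — the ONE-WINDOW identity member S17-W, PROVED:
# «local space–time Type I + similarity Riesz pressure shift-invariant MODULO CONSTANTS on ONE window ⇒ backward bounded»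

Cell ns-regularity-ideate, seat `ns-pressure-K2-p1` g5 (LEAD lineage of the closed crux K2⁺ stmt-NavierStokesRegularity-20180;
THEOREMS-ONLY sequel per ROUND-16 §4 Day 3 «S17 follows once the two supports are kitted» and DIRECTOR-NS #32 (2)/#60; no route,
no item; nsreg-p1 g19 NO OBJECTION 19:51:45Z).

The closed route proved the ONE-SIDED door S17⁺ (`Theses.LocalPressureProfileDoor.Target`): asymptotically non-increasing
similarity pressure AT EVERY similarity position ⇒ backward bounded.  The family standard, however, is a hypothesis read on
ONE off-centre similarity window.  This file lands the identity member on one window, in the GAUGE-FREE VALUE FORM: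

* `pressureWindowRigidity` — **profile side**: a door-class profile (Type I in time, space–time Type-I decay, continuous on
  the open slab, unit-viscosity Oseen–Duhamel identity, divergence-free slices) whose similarity Riesz pressure
  `P(t,y) = (−t)·Q[v(t)](√(−t)y)` is shift-invariant MODULO CONSTANTS on ONE nonempty open window `U` (for all `t < 0`,
  `σ ∈ [0,1]`, the increment `P(e^{−σ}t, y) − P(t, y)` does not depend on `y ∈ U`) is not backward-singular at the apex —
  window → slab (`…PressureWindowToSlab.profilePressure_sub_eq_zero_of_isOpen`: analytic pressure GRADIENT from the momentum
  equation + decay at infinity) makes `P` shift-invariant everywhere, in particular shift-monotone, and the closed crux K2⁺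
  `…MonotonePressureProfileRigidity.monotonePressureProfileRigidity_proof` concludes;
* `windowPressureDoor` — **THE DOOR S17-W**: a classical Leray–Hopf flow from rapidly decaying data, locally SPACE–TIME Type I
  at `(x₀,T)`, whose similarity Riesz pressure `P(t,y) = (T−t)·Q[u(t)](x₀+√(T−t)y)` becomes shift-invariant modulo constants
  on ONE nonempty open similarity window `W` — for every shift `σ ∈ [0,1]` and all `y, y′ ∈ W`,
  `[P(s_σ(t), y) − P(s_σ(t), y′)] − [P(t, y) − P(t, y′)] → 0` as `t ↑ T`, `s_σ(t) = T − e^{−σ}(T−t)` — is backward bounded at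
  `x₀`.  Proof: K1 `…LocalPointZoomSimilarityPressure.LocalPointZoomSimilarityPressure_proof` (value clause of the zoom) passes
  the hypothesis to the profile on the window `(√ν)⁻¹W`, then `pressureWindowRigidity`;
* `windowPressureDoor_of_value` — the value form (`P(s_σ(t), y) − P(t, y) → 0` for `y ∈ W`) as a corollary.

The planner's S17 as typed (shift-invariance of the similarity pressure GRADIENT on one window) would need the gradient clause of
K1 (not in the filed K1); on a connected window it differs from the form above only in the mode of convergence.

WHAT THIS IS NOT: not NS regularity (Clay A), not a Type-I Liouville theorem — a CONDITIONAL door theorem of the family (the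
Type-I rate and the pressure invariance are HYPOTHESES; the hard cores 0056/10661/1217 are evaded, not attacked); bears_on
LADDER-NS N0, rung N0-LocalTubeDoorPressureProfile (sequel).
-/

noncomputable section

-- the summit and its single sub-problem share the name (CONVENTIONS §1), as in every Theorems file
set_option linter.dupNamespace false

namespace Summit.NavierStokesRegularity.NavierStokesRegularity.Theorems.LocalPressureProfileDoorWindowTarget

open MeasureTheory Set Function Filter Topology TopologicalSpace Metric
open Literature.Analysis Literature.Analysis.FluidPDE
open Summit.NavierStokesRegularity.NavierStokesRegularity.Theorems
open Summit.NavierStokesRegularity.NavierStokesRegularity.Theorems.LocalPressureProfileDoorPressureWindowToSlab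

/-! ### The profile crux in window form -/

/-- **ONE-WINDOW PRESSURE RIGIDITY (profile side of S17-W).**  Let `v` be a profile of the door class — Type I in time,
space–time Type-I decay, continuous on the open backward slab, unit-viscosity Oseen–Duhamel identity between negative times,
divergence-free slices — and suppose that on ONE nonempty open window `U` its similarity Riesz pressure
`P(t, y) = (−t)·Q[v(t)](√(−t) y)` is SHIFT-INVARIANT MODULO CONSTANTS: for all `t < 0`, `σ ∈ [0,1]`, the increment
`P(e^{−σ}t, y) − P(t, y)` does not depend on `y ∈ U`.  Then `v` is not backward-singular at the apex `(0,0)`: window → slab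
(`profilePressure_sub_eq_zero_of_isOpen`) makes the similarity pressure shift-invariant at every `y`, in particular
shift-monotone, and the closed crux K2⁺ `monotonePressureProfileRigidity_proof` applies. -/
theorem pressureWindowRigidity :
    ∀ (C D : ℝ) (v : ℝ → EuclideanSpace ℝ (Fin 3) → EuclideanSpace ℝ (Fin 3)),
    Literature.Analysis.FluidPDE.HasTypeITimeDecay C v →
    Literature.Analysis.FluidPDE.HasTypeIDecay D v →
    ContinuousOn (Function.uncurry v) (Set.Iio (0 : ℝ) ×ˢ Set.univ) →
    (∀ s t : ℝ, s < t → t < 0 → ∀ x, v t x =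
      Literature.Analysis.UnboundedOperators.heatExtension (v s) (t - s) x -
        Literature.Analysis.FluidPDE.oseenDuhamel 1 s v v t x) →
    (∀ t < 0, Literature.Analysis.FluidPDE.VectorCalculus.IsDivFree (v t)) →
    (∃ U : Set (EuclideanSpace ℝ (Fin 3)), IsOpen U ∧ U.Nonempty ∧
      ∀ t < 0, ∀ σ ∈ Set.Icc (0 : ℝ) 1, ∀ y ∈ U, ∀ y' ∈ U,
        (-(Real.exp (-σ) * t)) * Literature.Analysis.FluidPDE.pressurePotential (v (Real.exp (-σ) * t))
            (Real.sqrt (-(Real.exp (-σ) * t)) • y) -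
          (-t) * Literature.Analysis.FluidPDE.pressurePotential (v t) (Real.sqrt (-t) • y) =
        (-(Real.exp (-σ) * t)) * Literature.Analysis.FluidPDE.pressurePotential (v (Real.exp (-σ) * t))
            (Real.sqrt (-(Real.exp (-σ) * t)) • y') -
          (-t) * Literature.Analysis.FluidPDE.pressurePotential (v t) (Real.sqrt (-t) • y')) →
    ¬ Literature.Analysis.FluidPDE.IsBackwardSingularPoint v 0 := by
  intro C D v hrate hdecay hcont hmild hdiv hwin
  obtain ⟨U, hU, hne, hwin⟩ := hwin
  refine LocalPressureProfileDoorMonotonePressureProfileRigidity.monotonePressureProfileRigidity_proof C D v hrate hdecay hcont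
    hmild hdiv (fun t ht σ hσ y => le_of_eq ?_)
  have ht' : Real.exp (-σ) * t < 0 := mul_neg_of_pos_of_neg (Real.exp_pos _) ht
  exact sub_eq_zero.1 (profilePressure_sub_eq_zero_of_isOpen hdecay hcont hmild hdiv ht' ht hU hne (hwin t ht σ hσ) y)

/-! ### The door -/

/-- **DOOR S17-W — the one-window identity member of `LocalPressureProfileDoor`, PROVED (a CONDITIONAL door theorem).**  A classical
Navier–Stokes solution on `[0,T)` (viscosity `ν > 0`), Leray–Hopf from a rapidly decaying datum, locally SPACE–TIME Type I at
`(x₀,T)` — `‖u(t,x)‖ (‖x − x₀‖ + √(ν(T−t))) ≤ M` on `B(x₀,ρ) × (T−ρ²,T)` — whose similarity Riesz pressure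
`P(t,y) = (T−t)·Q[u(t)](x₀ + √(T−t) y)` (`Q = pressurePotential`, the gauge-free Riesz pressure `RᵢRⱼ(uᵢuⱼ)`) becomes
SHIFT-INVARIANT MODULO CONSTANTS on ONE nonempty open similarity window `W` — for every shift `σ ∈ [0,1]` and all `y, y′ ∈ W`,
`[P(s_σ(t), y) − P(s_σ(t), y′)] − [P(t, y) − P(t, y′)] → 0` as `t ↑ T`, with `s_σ(t) = T − e^{−σ}(T − t)` the similarity-time
shift — is backward bounded at `x₀`.  Velocity free: no profile convergence, no smallness constant, no sign condition.
Proof: K1 (the zoom converges on the similarity pressure, `LocalPointZoomSimilarityPressure_proof`) passes the window identity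
to the profile on `(√ν)⁻¹ • W`; `pressureWindowRigidity` contradicts the singular apex. -/
theorem windowPressureDoor :
    ∀ (ν T : ℝ), 0 < ν → 0 < T → ∀ (u : ℝ → EuclideanSpace ℝ (Fin 3) → EuclideanSpace ℝ (Fin 3))
      (p : ℝ → EuclideanSpace ℝ (Fin 3) → ℝ),
    Literature.Analysis.FluidPDE.IsClassicalNSSolutionOn (Set.Ico 0 T) ν 0 u p →
    Literature.Analysis.FluidPDE.IsLerayHopfOn T ν 0 (u 0) u →
    Literature.Analysis.FluidPDE.HasRapidSpatialDecay (u 0) →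
    ∀ (x₀ : EuclideanSpace ℝ (Fin 3)) (ρ M : ℝ), 0 < ρ →
    (∀ t ∈ Set.Ico 0 T, T - ρ ^ 2 < t → ∀ x ∈ Metric.ball x₀ ρ,
      ‖u t x‖ * (‖x - x₀‖ + Real.sqrt (ν * (T - t))) ≤ M) →
    ∀ (W : Set (EuclideanSpace ℝ (Fin 3))), IsOpen W → W.Nonempty →
    (∀ σ ∈ Set.Icc (0 : ℝ) 1, ∀ y ∈ W, ∀ y' ∈ W, Filter.Tendsto (fun t =>
        ((T - (T - Real.exp (-σ) * (T - t))) *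
            Literature.Analysis.FluidPDE.pressurePotential (u (T - Real.exp (-σ) * (T - t)))
              (x₀ + Real.sqrt (T - (T - Real.exp (-σ) * (T - t))) • y) -
          (T - (T - Real.exp (-σ) * (T - t))) *
            Literature.Analysis.FluidPDE.pressurePotential (u (T - Real.exp (-σ) * (T - t)))
              (x₀ + Real.sqrt (T - (T - Real.exp (-σ) * (T - t))) • y')) -
        ((T - t) * Literature.Analysis.FluidPDE.pressurePotential (u t) (x₀ + Real.sqrt (T - t) • y) -
          (T - t) * Literature.Analysis.FluidPDE.pressurePotential (u t) (x₀ + Real.sqrt (T - t) • y')))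
      (nhdsWithin T (Set.Iio T)) (nhds 0)) →
    Literature.Analysis.FluidPDE.IsBackwardBoundedAt u T x₀ := by
  intro ν T hν hT u p hcl hLH hdec x₀ ρ M hρ hM W hWo hWne hwin
  by_contra hnot
  obtain ⟨C, D, v, lam, hlam, hlam0, hrate, hdecay, hcont, hmild, hdiv, hsing, hconv⟩ :=
    LocalPressureProfileDoorLocalPointZoomSimilarityPressure.LocalPointZoomSimilarityPressure_proof ν T hν hT u p hcl hLH
      hdec x₀ ρ M hρ hM hnot
  have hsν : 0 < Real.sqrt ν := Real.sqrt_pos.2 hν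
  -- the zoom times `tⱼ = T + λⱼ² t/ν → T⁻`
  have key : ∀ t < (0 : ℝ), Filter.Tendsto (fun j : ℕ => T + lam j ^ 2 * t / ν) Filter.atTop
      (nhdsWithin T (Set.Iio T)) := by
    intro t ht
    refine tendsto_nhdsWithin_iff.2 ⟨?_, Filter.Eventually.of_forall fun j => ?_⟩
    · have h1 : Filter.Tendsto (fun j : ℕ => T + lam j ^ 2 * t / ν) Filter.atTop (nhds (T + 0 ^ 2 * t / ν)) :=
        tendsto_const_nhds.add (((hlam0.pow 2).mul_const t).div_const ν)
      simpa using h1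
    · show T + lam j ^ 2 * t / ν < T
      have : lam j ^ 2 * t / ν < 0 :=
        div_neg_of_neg_of_pos (mul_neg_of_pos_of_neg (pow_pos (hlam j) 2) ht) hν
      linarith
  -- the profile's similarity pressure is shift-invariant modulo constants on the window `(√ν)⁻¹ • W`
  refine pressureWindowRigidity C D v hrate hdecay hcont hmild hdiv
    ⟨(fun z : EuclideanSpace ℝ (Fin 3) => Real.sqrt ν • z) ⁻¹' W, hWo.preimage (continuous_const_smul _), ?_,
      fun t ht σ hσ y hy y' hy' => ?_⟩ hsing
  · obtain ⟨w₀, hw₀⟩ := hWne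
    refine ⟨(Real.sqrt ν)⁻¹ • w₀, ?_⟩
    show Real.sqrt ν • ((Real.sqrt ν)⁻¹ • w₀) ∈ W
    rwa [smul_smul, mul_inv_cancel₀ hsν.ne', one_smul]
  · have ht' : Real.exp (-σ) * t < 0 := mul_neg_of_pos_of_neg (Real.exp_pos _) ht
    -- the four limits of K1
    have h4 := ((hconv (Real.exp (-σ) * t) ht' y).sub (hconv (Real.exp (-σ) * t) ht' y')).sub
      ((hconv t ht y).sub (hconv t ht y'))
    -- the door hypothesis along the zoom times
    have h3 := (hwin σ hσ (Real.sqrt ν • y) hy (Real.sqrt ν • y') hy').comp (key t ht)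
    have e : ∀ j : ℕ, T - Real.exp (-σ) * (T - (T + lam j ^ 2 * t / ν)) = T + lam j ^ 2 * (Real.exp (-σ) * t) / ν :=
      fun j => by ring
    have h5 := h3.const_mul ν⁻¹
    rw [mul_zero] at h5
    have h5' : Filter.Tendsto (fun j : ℕ =>
        ν⁻¹ * ((T - (T + lam j ^ 2 * (Real.exp (-σ) * t) / ν)) *
            pressurePotential (u (T + lam j ^ 2 * (Real.exp (-σ) * t) / ν))
              (x₀ + Real.sqrt (T - (T + lam j ^ 2 * (Real.exp (-σ) * t) / ν)) • (Real.sqrt ν • y))) -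
          ν⁻¹ * ((T - (T + lam j ^ 2 * (Real.exp (-σ) * t) / ν)) *
            pressurePotential (u (T + lam j ^ 2 * (Real.exp (-σ) * t) / ν))
              (x₀ + Real.sqrt (T - (T + lam j ^ 2 * (Real.exp (-σ) * t) / ν)) • (Real.sqrt ν • y'))) -
          (ν⁻¹ * ((T - (T + lam j ^ 2 * t / ν)) * pressurePotential (u (T + lam j ^ 2 * t / ν))
              (x₀ + Real.sqrt (T - (T + lam j ^ 2 * t / ν)) • (Real.sqrt ν • y))) -
            ν⁻¹ * ((T - (T + lam j ^ 2 * t / ν)) * pressurePotential (u (T + lam j ^ 2 * t / ν))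
              (x₀ + Real.sqrt (T - (T + lam j ^ 2 * t / ν)) • (Real.sqrt ν • y')))))
        Filter.atTop (nhds 0) := by
      refine h5.congr fun j => ?_
      simp only [Function.comp_apply]
      rw [e j]
      ring
    have := tendsto_nhds_unique h4 h5'
    linarith

/-- **Door S17-W, value form.**  Same frame; hypothesis: on ONE nonempty open similarity window `W`, for every shift `σ ∈ [0,1]`
and every `y ∈ W`, the similarity Riesz pressure becomes shift-invariant, `P(s_σ(t), y) − P(t, y) → 0` as `t ↑ T`.  Then `x₀` is
backward bounded (differences of two such sequences give the modulo-constants form of `windowPressureDoor`). -/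
theorem windowPressureDoor_of_value :
    ∀ (ν T : ℝ), 0 < ν → 0 < T → ∀ (u : ℝ → EuclideanSpace ℝ (Fin 3) → EuclideanSpace ℝ (Fin 3))
      (p : ℝ → EuclideanSpace ℝ (Fin 3) → ℝ),
    Literature.Analysis.FluidPDE.IsClassicalNSSolutionOn (Set.Ico 0 T) ν 0 u p →
    Literature.Analysis.FluidPDE.IsLerayHopfOn T ν 0 (u 0) u →
    Literature.Analysis.FluidPDE.HasRapidSpatialDecay (u 0) →
    ∀ (x₀ : EuclideanSpace ℝ (Fin 3)) (ρ M : ℝ), 0 < ρ →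
    (∀ t ∈ Set.Ico 0 T, T - ρ ^ 2 < t → ∀ x ∈ Metric.ball x₀ ρ,
      ‖u t x‖ * (‖x - x₀‖ + Real.sqrt (ν * (T - t))) ≤ M) →
    ∀ (W : Set (EuclideanSpace ℝ (Fin 3))), IsOpen W → W.Nonempty →
    (∀ σ ∈ Set.Icc (0 : ℝ) 1, ∀ y ∈ W, Filter.Tendsto (fun t =>
        (T - (T - Real.exp (-σ) * (T - t))) *
            Literature.Analysis.FluidPDE.pressurePotential (u (T - Real.exp (-σ) * (T - t)))
              (x₀ + Real.sqrt (T - (T - Real.exp (-σ) * (T - t))) • y) -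
          (T - t) * Literature.Analysis.FluidPDE.pressurePotential (u t) (x₀ + Real.sqrt (T - t) • y))
      (nhdsWithin T (Set.Iio T)) (nhds 0)) →
    Literature.Analysis.FluidPDE.IsBackwardBoundedAt u T x₀ := by
  intro ν T hν hT u p hcl hLH hdec x₀ ρ M hρ hM W hWo hWne hwin
  refine windowPressureDoor ν T hν hT u p hcl hLH hdec x₀ ρ M hρ hM W hWo hWne fun σ hσ y hy y' hy' => ?_
  have h := (hwin σ hσ y hy).sub (hwin σ hσ y' hy')
  rw [sub_zero] at h
  exact h.congr fun t => by ring

end Summit.NavierStokesRegularity.NavierStokesRegularity.Theorems.LocalPressureProfileDoorWindowTarget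

end
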